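import Summits.HodgeConjecture.HodgeConjecture.Theses.AnchorTransport
import Summits.HodgeConjecture.HodgeConjecture.Theorems.AnchorTransportAnchorExistenceStubDefinableOfRigid
import Literature.AlgebraicGeometry.HodgeTheory.HodgeGenericQbarDescentFiniteMonodromyInputs
import Literature.AlgebraicGeometry.HodgeTheory.AlgebraicCyclesDefinedOverQbar
import Literature.AlgebraicGeometry.HodgeTheory.HodgeTypeExteriorProduct
import HarnessLib

/-!
# Route `AnchorTransport` — crux `AnchorExistence` (stmt-HodgeConjecture-1077), line `qbar-fibre-anchors`:
# the FAMILY form of Voisin's `ℚ̄`-mechanism (part A of the reduction of stub 4)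

Helper file for the crux item stmt-HodgeConjecture-1077 (`--supports`; it closes nothing), line
`qbar-fibre-anchors` (`Cruxes/AnchorExistence/Lines/qbar_fibre_anchors.lean`, lead c5), registered
sub-goal `qbarFibreFamily_of_finiteMonodromy`.  Stub 4 of the line (`stub_qbarFibreAnchor_of_pairMovable`,
the GEOGRAPHY in `ℚ̄`-form: a Hodge pair `(X, c)` deforms, inside ONE smooth projective family over a
smooth irreducible base carrying ONE global fibrewise rational `(p,p)` class restricting to `c`, to a fibre
DEFINABLE OVER A NUMBER FIELD) is, on the tree's carriers, Voisin's `ℚ̄`-funnel (Voisin 2007, §3, proof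
of Prop. 0.7 = arXiv math/0605766 Prop. 1.7; Charles–Schnell Thm. 11.3.19) read with the FAMILY as
output instead of the envelope.  This file proves that mechanism in family form, granted its two
classical inputs — (C) Riemann's existence theorem with `ℚ̄`-descent of finite étale covers (named fact
`FundamentalGroup.riemannExistence_qbarDescent_of_finiteIndex`, SGA1 XII 5.1 + XIII 4.6) and (D)
Deligne's global invariant cycle theorem (named fact `deligne_globalInvariantCycles`, Hodge II 4.1.1):

> for `σ : ℚ̄ →+* ℂ`, a `ℚ̄`-morphism `f₀ : 𝒳₀ ⟶ S₀` of quasi-projective `ℚ̄`-schemes with `S₀` smooth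
> irreducible and smooth projective complexification `f`, a complex point `s` and a rational `(p,p)`
> class `α` on `𝒳_s` with FINITE monodromy orbit, there are a smooth projective family `f' : 𝒳' ⟶ S'`
> over a smooth irreducible `ℂ`-base, `e' : 𝒳_s ≅ 𝒳'_{s'}`, a GLOBAL class `A ∈ H²ᵖ(𝒳'(ℂ); ℂ)`
> restricting on EVERY fibre to a rational `(p,p)` class, with `e'^*(A|_{𝒳'_{s'}}) = α`, and a complex
> point `s₀` of `S'` whose fibre is the complexification `Y₀ ⊗_σ ℂ` of a `ℚ̄`-scheme.

Steps 1–6 are those of `Theorems.stub_dominantEnvelopeOfFiniteMonodromy` (p119525; finite orbit ⟹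
finite-index stabiliser; the finite étale cover `S₀' → S₀` over `ℚ̄` from (C); the pulled-back family
`f' : 𝒳 ×_S S' ⟶ S' = S₀' ⊗ ℂ` and the continuous global section through `(s', e'^* α)`; the smooth
projective compactification `i : 𝒳 ×_S S' ↪ X̄₀ ⊗_σ ℂ` over `ℚ̄` — Hironaka over `ℚ̄` is the tree's
theorem `exists_isSmoothProjective_isOpenImmersion`; the Hodge lift `β` of the invariant section from
(D), polarisability being the tree's theorem `smoothProjective_hodgeStructure_isPolarizable_holds`).
Step 7 (new) is the packaging: `A := i^* β` is fibrewise rational (`IsRationalClass.map`) and fibrewise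
of type `(p,p)` because `A|_{𝒳'_t} = (𝒳'_t ⟶ 𝒳' ⟶ X̄₀ ⊗ ℂ)^* β` is a pull-back between smooth
projective varieties (`IsOfHodgeType.map_of_isSmoothProjective`, PROVED, Voisin I §7.3.2); a
`ℚ̄`-rational point `w'` of `S₀'` (`exists_ratPoint_pt_mem_of_isOpen`, Nullstellensatz) lifts to a
complex point `s₀` of `S'` (`exists_algPoint_baseChangeHom_over`), and
`𝒳'_{s₀} ≅ 𝒳_{g s₀} ≅ (𝒳₀)_{g₀ w'} ⊗_σ ℂ` (`fiberOverFamilyPullbackIso` and the base-change lemma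
`fiberOver_baseChangeHom_iso_of_over` of the sibling stub-2 file `AnchorTransportAnchorExistenceStubDefinableOfRigid`).

* `qbarFibreFamily_of_finiteMonodromy` — the registered sub-goal: (C) → (D) → the family form.

Part B (`AnchorTransportAnchorExistenceQbarFibreAssembly.lean`) assembles from it, the spreading-out
theorem, the number-field models of smooth projective `ℚ̄`-schemes (`stub_numberFieldModel`, p145483)
and a transcendence input (type stability at `ℚ̄`-generic points / `QbarGenericIsHodgeGeneric`) the
`ℚ̄`-fibre anchors of ALL Hodge pairs, hence stub 4 verbatim.
-/

-- every declaration of this problem lives in `Summit.HodgeConjecture.HodgeConjecture.…`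
set_option linter.dupNamespace false

noncomputable section

open CategoryTheory AlgebraicGeometry
open Literature.AlgebraicGeometry Literature.AlgebraicGeometry.Motives
  Literature.AlgebraicGeometry.HodgeTheory Literature.AlgebraicTopology.SingularHomology
open Summit.HodgeConjecture.HodgeConjecture.Theses.AnchorTransport
open Summit.HodgeConjecture.HodgeConjecture.Theorems

namespace Summit.HodgeConjecture.HodgeConjecture.Theorems.QbarFibreAnchors

/-! ### Voisin's finite-monodromy mechanism with the FAMILY as output -/

section Mechanism

open CategoryTheory.Limits
open scoped Topology

-- adapted from `Theorems.stub_dominantEnvelopeOfFiniteMonodromy` (Steps 1–6 verbatim; new packaging)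
/-- **The family form of Voisin's mechanism** (Voisin 2007, §3, proof of Prop. 0.7; Charles–Schnell
Thm. 11.3.19): for `σ : ℚ̄ →+* ℂ`, a `ℚ̄`-morphism `f₀ : 𝒳₀ ⟶ S₀` of quasi-projective `ℚ̄`-schemes
with `S₀` smooth irreducible whose complexification `f` is a smooth projective family of relative
dimension `n`, a complex point `s` and a rational `(p,p)` class `α` on `𝒳_s` with FINITE monodromy
orbit — granted Riemann's existence theorem with `ℚ̄`-descent (C) and Deligne's global invariant cycle
theorem (D) — there are: a smooth projective family `f' : 𝒳' ⟶ S'` of relative dimension `n` over a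
smooth irreducible `ℂ`-base (the pull-back of `f` to a finite étale cover `S' = S₀' ⊗_σ ℂ` killing the
monodromy of `α`), an isomorphism `e' : 𝒳_s ≅ 𝒳'_{s'}`, a GLOBAL class `A ∈ H²ᵖ(𝒳'(ℂ); ℂ)`
(`A = i^* β`, `β` the Hodge lift on a smooth projective compactification `i : 𝒳' ↪ X̄₀ ⊗_σ ℂ`)
whose restriction to EVERY fibre is rational of type `(p,p)` and with `e'^*(A|_{𝒳'_{s'}}) = α`, and a
complex point `s₀` of `S'` (over a `ℚ̄`-rational point of `S₀'`) whose fibre is the complexification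
`Y₀ ⊗_σ ℂ` of a `ℚ̄`-scheme `Y₀` (a `ℚ̄`-fibre of `f₀`).
[cite: Voisin2007HodgeLoci, §3, proof of Prop. 0.7 (arXiv math/0605766 Prop. 1.7, p. 7)]
[cite: CharlesSchnell2014Notes, Thm. 11.3.19 (proof)] [cite: SGA1, Exp. XII Thm. 5.1 and Exp. XIII Prop. 4.6]
[cite: DeligneHodgeII1971, Théorème 4.1.1] -/
theorem qbarFibreFamily_of_finiteMonodromy :
    Literature.AlgebraicGeometry.FundamentalGroup.riemannExistence_qbarDescent_of_finiteIndex →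
    Literature.AlgebraicGeometry.HodgeTheory.deligne_globalInvariantCycles →
    ∀ (σ : AlgebraicClosure ℚ →+* ℂ) ⦃𝒳₀ S₀ : SchemeOver (AlgebraicClosure ℚ)⦄ (f₀ : 𝒳₀ ⟶ S₀)
      (n p : ℕ), IsQuasiProjectiveOver 𝒳₀ → IsQuasiProjectiveOver S₀ → IrreducibleSpace S₀.left →
      AlgebraicGeometry.Smooth S₀.hom → IsSmoothProjectiveFamily ((baseChangeHom σ).map f₀) n →
      ∀ (s : ComplexPoints ((baseChangeHom σ).obj S₀))
        (α : complexBetti (fiberOver ((baseChangeHom σ).map f₀) s) (2 * p)),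
        IsRationalClass α → IsOfHodgeType n (fiberOver ((baseChangeHom σ).map f₀) s) (2 * p) p p α →
        {β : complexBetti (fiberOver ((baseChangeHom σ).map f₀) s) (2 * p) |
            ∃ γ : Path s s, IsContinuationAlong γ α β}.Finite →
        ∃ (𝒳' S' : SchemeOver ℂ) (f' : 𝒳' ⟶ S') (s' s₀ : ComplexPoints S')
          (e' : fiberOver ((baseChangeHom σ).map f₀) s ≅ fiberOver f' s') (A : complexBetti 𝒳' (2 * p))
          (Y₀ : SchemeOver (AlgebraicClosure ℚ)),
          IsSmoothProjectiveFamily f' n ∧ IrreducibleSpace S'.left ∧ AlgebraicGeometry.Smooth S'.hom ∧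
          (∀ t : ComplexPoints S', IsRationalClass (complexBetti.map (fiberι f' t) (2 * p) A) ∧
            IsOfHodgeType n (fiberOver f' t) (2 * p) p p (complexBetti.map (fiberι f' t) (2 * p) A)) ∧
          complexBetti.map e'.hom (2 * p) (complexBetti.map (fiberι f' s') (2 * p) A) = α ∧
          Nonempty (fiberOver f' s₀ ≅ (baseChangeHom σ).obj Y₀) := by
  intro hRE hD σ 𝒳₀ S₀ f₀ n p h𝒳₀ hS₀ hirr hsm hf s α hαr hαh hfin
  haveI := hirr
  -- Step 1 (the orbit): finite orbit ⟹ a finite-index subgroup `H ≤ π₁(S(ℂ), s)` fixes `α`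
  obtain ⟨hU, H, hHfi, hHfix⟩ :=
    exists_finiteIndex_of_finite_setOf_isContinuationAlong_of_qbarFamily σ f₀ (2 * p) hS₀ hsm hf
      s α hfin
  -- Step 2 (the finite étale cover `S' → S`, defined over `ℚ̄`): Riemann existence + descent
  obtain ⟨S₀', g₀, s', hs, hS₀'qp, hS'irr, hg₀, hg₀fin, hloops⟩ := hRE σ S₀ hS₀ hirr hsm s H hHfi
  subst hs
  -- Step 3: the bases `S = S₀ ⊗ ℂ`, `S' = S₀' ⊗ ℂ` are smooth of the same pure dimension `d`,
  -- quasi-projective; `S'(ℂ)` is a connected manifold; `g(ℂ)` is a local homeomorphism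
  haveI := hsm
  obtain ⟨d, hd⟩ := Motives.exists_smoothOfRelativeDimension_of_smooth S₀.hom
  haveI := hd
  haveI hSd : SmoothOfRelativeDimension d ((baseChangeHom σ).obj S₀).hom :=
    smoothOfRelativeDimension_baseChangeHom_hom σ d S₀
  have hSqp : IsQuasiProjectiveOver ((baseChangeHom σ).obj S₀) := hS₀.baseChangeHom σ
  have hS'qp : IsQuasiProjectiveOver ((baseChangeHom σ).obj S₀') := hS₀'qp.baseChangeHom σ
  haveI : LocallyOfFiniteType ((baseChangeHom σ).obj S₀).hom := hSqp.locallyOfFiniteType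
  haveI : LocallyOfFiniteType ((baseChangeHom σ).obj S₀').hom := hS'qp.locallyOfFiniteType
  haveI : IsSeparated ((baseChangeHom σ).obj S₀).hom := hSqp.isVarietyPair_ofScheme.isSeparated
  haveI := hg₀
  haveI := hg₀fin
  haveI hg0 : SmoothOfRelativeDimension 0 ((baseChangeHom σ).map g₀).left := by
    letI := σ.toAlgebra
    have := smoothOfRelativeDimension_isStableUnderBaseChange 0
    exact MorphismProperty.of_isPullback (P := @SmoothOfRelativeDimension 0)
      (Motives.isPullback_baseChange_map_left ℂ g₀).flip inferInstance
  haveI : AlgebraicGeometry.Smooth ((baseChangeHom σ).map g₀).left :=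
    SmoothOfRelativeDimension.smooth 0 _
  haveI hS'd : SmoothOfRelativeDimension d ((baseChangeHom σ).obj S₀').hom := by
    have h : SmoothOfRelativeDimension (0 + d)
        (((baseChangeHom σ).map g₀).left ≫ ((baseChangeHom σ).obj S₀).hom) :=
      inferInstance
    rw [Over.w] at h
    simpa using h
  haveI : IrreducibleSpace ((baseChangeHom σ).obj S₀').left := hS'irr
  haveI : ConnectedSpace (ComplexPoints ((baseChangeHom σ).obj S₀')) :=
    (Motives.ComplexPoints.connectedSpace_iff_holds _).2 inferInstance
  haveI : PathConnectedSpace (ComplexPoints ((baseChangeHom σ).obj S₀')) :=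
    pathConnectedSpace_complexPoints_of_smoothOfRelativeDimension _ d
  letI := Motives.ComplexPoints.chartedSpace ((baseChangeHom σ).obj S₀') d
  haveI : LocallyPathConnectedSpace (ComplexPoints ((baseChangeHom σ).obj S₀')) :=
    ChartedSpace.locallyPathConnectedSpace (EuclideanSpace ℝ (Fin (2 * d))) _
  have hgloc : IsLocalHomeomorph (AlgPoints.map ((baseChangeHom σ).map g₀) :
      ComplexPoints ((baseChangeHom σ).obj S₀') → ComplexPoints ((baseChangeHom σ).obj S₀)) :=
    Motives.ComplexPoints.isLocalHomeomorph_map d _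
  -- Step 4 (base change of the family): `f' : 𝒳 ×_S S' ⟶ S'` is smooth projective, `R^{2p} f'_* ℂ`
  -- is a local system, and `α' = e^* α` is monodromy invariant, hence a continuous global section
  have hf' := hf.familyPullback_snd ((baseChangeHom σ).map g₀)
  have hU' := isCohomologicallyLocallyTrivialOn_univ_of_isSmoothProjectiveFamily
    (familyPullback.snd ((baseChangeHom σ).map f₀) ((baseChangeHom σ).map g₀)) d hf' hS'qp
  set e := fiberOverFamilyPullbackIso ((baseChangeHom σ).map f₀) ((baseChangeHom σ).map g₀) s'
    with he
  have hinv : ∀ γ' : Path (⟨s', Set.mem_univ s'⟩ :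
      (Set.univ : Set (ComplexPoints ((baseChangeHom σ).obj S₀')))) ⟨s', Set.mem_univ s'⟩,
      transportFun ((baseChangeHom σ).map f₀) (2 * p) hU
        (s := ⟨AlgPoints.map ((baseChangeHom σ).map g₀) s', Set.mem_univ _⟩)
        (t := ⟨AlgPoints.map ((baseChangeHom σ).map g₀) s', Set.mem_univ _⟩)
        ⟦γ'.map ((((AlgPoints.continuous_map ((baseChangeHom σ).map g₀)).comp
          continuous_subtype_val)).subtype_mk fun _ ↦ Set.mem_univ _)⟧ α = α :=
    fun γ' ↦ hHfix _ (hloops γ')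
  obtain ⟨σ', hσ'c, hσ'pt, hσ'₀⟩ := exists_continuous_section_familyPullback
    ((baseChangeHom σ).map f₀) ((baseChangeHom σ).map g₀) (2 * p) hgloc hU hU' s'
    (complexBetti.map e.hom (2 * p) α) (FiberClass.cls_baseChange_map_hom _ _ _ s' α) hinv
  have h₀ : σ' s' ∈ locusOfHodgeClasses
      (familyPullback.snd ((baseChangeHom σ).map f₀) ((baseChangeHom σ).map g₀)) n p := by
    rw [hσ'₀]
    exact ⟨hαr.map _, hαh.map_of_iso e⟩
  -- Step 5 (a smooth projective compactification DEFINED OVER `ℚ̄`): `X₀' = 𝒳₀ ×_{S₀} S₀'` is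
  -- quasi-projective, smooth, irreducible of some pure dimension `m`, hence an open subscheme
  -- `i₀ : X₀' ↪ X̄₀` of a smooth projective `X̄₀` (Hironaka, proved), and `𝒳 ×_S S' ≅ X₀' ⊗_σ ℂ`
  set X₀' : SchemeOver (AlgebraicClosure ℚ) := familyPullback f₀ g₀ with hX₀'
  haveI : IsSeparated S₀.hom := isSeparated_hom_of_isQuasiProjectiveOver hS₀
  have hX₀'qp : IsQuasiProjectiveOver X₀' :=
    isQuasiProjectiveOver_familyPullback_of_isSeparated f₀ g₀ h𝒳₀ hS₀'qp
  haveI : AlgebraicGeometry.Smooth ((baseChangeHom σ).map f₀).left := hf.smooth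
  haveI : AlgebraicGeometry.Smooth f₀.left := smooth_of_smooth_baseChangeHom_map_left σ f₀
  haveI : AlgebraicGeometry.Smooth 𝒳₀.hom := by
    rw [← Over.w f₀]
    infer_instance
  haveI : AlgebraicGeometry.Smooth X₀'.hom := by
    change AlgebraicGeometry.Smooth (pullback.fst f₀.left g₀.left ≫ 𝒳₀.hom)
    infer_instance
  haveI : IrreducibleSpace
      (familyPullback ((baseChangeHom σ).map f₀) ((baseChangeHom σ).map g₀)).left :=
    irreducibleSpace_of_isSmoothProjectiveFamily _ hf'
  obtain ⟨eXP, -, heXP⟩ := exists_familyPullback_iso_baseChangeHom_obj σ f₀ g₀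
  set eXP' : (familyPullback ((baseChangeHom σ).map f₀) ((baseChangeHom σ).map g₀)).left ≅
      ((baseChangeHom σ).obj X₀').left := (Over.forget _).mapIso eXP with heXP'
  haveI : IrreducibleSpace ((baseChangeHom σ).obj X₀').left :=
    (Scheme.homeoOfIso eXP').surjective.irreducibleSpace (Scheme.homeoOfIso eXP').continuous
  haveI : IrreducibleSpace X₀'.left := irreducibleSpace_of_irreducibleSpace_baseChangeHom_obj σ X₀'
  obtain ⟨m, hm⟩ := exists_smoothOfRelativeDimension_of_smooth X₀'.hom
  obtain ⟨Xbar₀, i₀, hXbar₀, hi₀⟩ :=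
    exists_isSmoothProjective_isOpenImmersion m X₀' hm hX₀'qp inferInstance
  haveI := hi₀
  have hXbar : IsSmoothProjective m ((baseChangeHom σ).obj Xbar₀) :=
    IsSmoothProjective.baseChangeHom_holds σ hXbar₀
  set i : familyPullback ((baseChangeHom σ).map f₀) ((baseChangeHom σ).map g₀) ⟶
      (baseChangeHom σ).obj Xbar₀ := eXP.hom ≫ (baseChangeHom σ).map i₀ with hi_def
  haveI hi : IsOpenImmersion i.left := by
    haveI := isOpenImmersion_baseChangeHom_map_left σ i₀
    haveI : IsOpenImmersion eXP.hom.left :=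
      (inferInstance : IsOpenImmersion ((Over.forget _).mapIso eXP).hom)
    rw [hi_def, Over.comp_left]
    infer_instance
  -- Step 6 (global invariant cycles + Hodge lift): a rational `(p,p)` class `β` on `X̄₀ ⊗_σ ℂ`
  -- with `(i^* β)|_{X'_{s'}} = α' = e^* α`
  obtain ⟨β, hβr, hβh, hβσ⟩ :=
    hD.exists_hodgeClass_eq_globalSection_of_exists_isReal_hodgeModel exists_isReal_hodgeModel_holds
      hodgePQ_independent_of_hodgeModel_holds smoothProjective_hodgeStructure_isPolarizable_holds _ i
      hf' hS'qp (SmoothOfRelativeDimension.smooth d _) hXbar hi hσ'c hσ'pt h₀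
  have hα'eq : complexBetti.map e.hom (2 * p) α =
      complexBetti.map (fiberι (familyPullback.snd ((baseChangeHom σ).map f₀)
        ((baseChangeHom σ).map g₀)) s') (2 * p) (complexBetti.map i (2 * p) β) :=
    (FiberClass.mk_eq_mk_iff _ _).1 (hσ'₀.symm.trans hβσ)
  -- Step 7 (NEW — a `ℚ̄`-fibre): a `ℚ̄`-rational point `w'` of `S₀'`, a complex point `s₀` of `S'`
  -- over it, and `𝒳'_{s₀} ≅ 𝒳_{g s₀} ≅ (𝒳₀)_{g₀ w'} ⊗_σ ℂ`
  haveI : IrreducibleSpace S₀'.left := irreducibleSpace_of_irreducibleSpace_baseChangeHom_obj σ S₀'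
  haveI : LocallyOfFiniteType S₀'.hom := locallyOfFiniteType_of_isQuasiProjectiveOver hS₀'qp
  obtain ⟨w', -⟩ := exists_ratPoint_pt_mem_of_isOpen S₀' isOpen_univ Set.univ_nonempty
  obtain ⟨s₀, hs₀⟩ := exists_algPoint_baseChangeHom_over (L := ℂ) σ S₀' w'
  have H : (AlgPoints.map ((baseChangeHom σ).map g₀) s₀).left ≫ baseChangeHomFst σ S₀ =
      Spec.map (CommRingCat.ofHom σ) ≫ (AlgPoints.map g₀ w').left := by
    rw [AlgPoints.map_apply, AlgPoints.map_apply, Over.comp_left, Over.comp_left, Category.assoc,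
      baseChangeHom_map_left_comp_fst, ← Category.assoc, hs₀]
    exact Category.assoc _ _ _
  obtain ⟨eY⟩ := fiberOver_baseChangeHom_iso_of_over σ f₀ (AlgPoints.map g₀ w')
    (AlgPoints.map ((baseChangeHom σ).map g₀) s₀) H
  -- packaging
  refine ⟨_, _, familyPullback.snd ((baseChangeHom σ).map f₀) ((baseChangeHom σ).map g₀), s', s₀,
    e.symm, complexBetti.map i (2 * p) β, fiberOver f₀ (AlgPoints.map g₀ w'), hf', hS'irr,
    SmoothOfRelativeDimension.smooth d _, fun t ↦ ?_, ?_,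
    ⟨fiberOverFamilyPullbackIso ((baseChangeHom σ).map f₀) ((baseChangeHom σ).map g₀) s₀ ≪≫ eY⟩⟩
  · -- fibrewise rational `(p,p)`: `A|_{𝒳'_t} = (𝒳'_t ⟶ 𝒳' ⟶ X̄₀ ⊗ ℂ)^* β`, a pull-back between smooth
    -- projective varieties (Voisin I §7.3.2, PROVED in the tree)
    refine ⟨(hβr.map _).map _, ?_⟩
    have h2 := hβh.map_of_isSmoothProjective
      ((hf'.isSmoothProjective t)) hXbar
      (fiberι (familyPullback.snd ((baseChangeHom σ).map f₀) ((baseChangeHom σ).map g₀)) t ≫ i)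
    rw [complexBetti.map_comp, CategoryTheory.comp_apply] at h2
    exact h2
  · -- `e'^*(A|_{s'}) = (e⁻¹)^* (e^* α) = α`
    rw [← hα'eq]
    exact e.symm.complexBetti_map_hom_map_inv (2 * p) α

end Mechanism

end Summit.HodgeConjecture.HodgeConjecture.Theorems.QbarFibreAnchors

end
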